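import Literature.NumberTheory.LFunctions.YoshidaWindowGramRecords
import Literature.NumberTheory.LFunctions.PsdDyadicCertificate
import HarnessLib

/-!
# Kernel enclosures of Yoshida's matrix coefficients — III: the entry box, sector boxes and the data checkers

Source: H. Yoshida, Adv. Stud. Pure Math. **21** (1992) 281–325, §5 (5.15)/(5.16) p. 301
[Yoshida1992HermitianForms].  Given valid constants `C` (`ConstsValid`) and valid special-value records at the
modes `n ≥ 0` (`IdxValid`) and `m ∈ ℤ` (`OffValid`; negative modes by `IdxRec.flip`), the total function
`Encl.gramBox S C Rn Rm n m : MI` is an interval containing `gramCoeff a n m` (`Encl.mem_gramBox`).  On top of it,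
`Encl.evenBox` / `Encl.oddBox` enclose the entries of the even / odd SECTOR KERNELS in exactly the conventions of
`Summits/…/WeilFormatCSectorKernels.lean` (`M⁺(0,m) = G(0,m)`, `M⁺(n,0) = G(n,0)`, `M⁺(n,m) = (G(n,m)+G(n,−m))/2`;
`M⁻(k,l) = (G(k+1,l+1) − G(k+1,−(l+1)))/2`).  Pure interval bookkeeping over part I; everything is proved.


Part V content (same file): LITERAL-DATA checkers turning claimed data into the hypotheses of a format-C decision —
* `Encl.checkPi`, `Encl.checkHalfLogNat`, `Encl.checkPiFrac`, `Encl.checkFrac` — a claimed interval contains `π`,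
  `(log q)/2`, `pπ/q`, `p/q`;
* `Encl.checkConsts` — a claimed `Consts` record is valid (recompute `Encl.consts`, test containment);
* `Encl.checkTable` — a slice of a claimed table of `IdxRec`s is valid (recompute `Encl.idxRec` per index, test
  containment), so that the expensive special values are certified ONCE per mode and shared by all entry files;
* `Encl.evenBox` / `Encl.oddBox` — boxes of the even / odd sector-kernel entries (`Encl.evenKernel`, `Encl.oddKernel`,
  the conventions of `WeilFormatCSectorKernels`);
* `Encl.checkRows` — for a band of rows, the integer data `D` at unit `2^{−c}` with radius `ρ` encloses the sector
  kernel of `gramCoeff a`: `|M(i,j) − D_{ij}·2^{−c}| ≤ ρ·2^{−c}` — the hypothesis `hM` of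
  `PsdDyadic.psd_of_checkPsdMid` (after folding a dyadic majorant `U` into `D`, `Encl.near_sub_of_near`).-/

open Real Complex Finset
open scoped BigOperators

namespace Literature.NumberTheory.LFunctions.Yoshida1992

open Literature.Analysis.SpecialFunctions Literature.Analysis.ValidatedNumerics.NumericsMP

namespace Encl

variable {S : ℕ} {a : ℝ}

/-! ## Small algebra -/

/-- The sign `(−1)^{n+m}` as an integer. [cite: Moore1966, Ch. 3 (interval arithmetic: inclusion property)] -/
def sgn (n m : ℤ) : ℤ := if (n + m) % 2 = 0 then 1 else -1

/-- `(−1)^{n+m} = sgn n m` in `ℝ`. [cite: Moore1966, Ch. 3 (interval arithmetic: inclusion property)] -/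
theorem neg_one_zpow_eq_sgn (n m : ℤ) : (-1 : ℝ) ^ (n + m) = (sgn n m : ℝ) := by
  unfold sgn
  split_ifs with h
  · have he : Even (n + m) := Int.even_iff.mpr h
    rw [he.neg_one_zpow]; simp
  · have ho : Odd (n + m) := Int.odd_iff.mpr (by omega)
    rw [ho.neg_one_zpow]; simp

/-- `1/(k : ℝ) = sign k / |k|` for an integer `k ≠ 0`. [cite: Moore1966, Ch. 3 (interval arithmetic: inclusion property)] -/
theorem inv_int_eq_sign_div_natAbs {k : ℤ} (hk : k ≠ 0) :
    (1 : ℝ) / (k : ℝ) = (k.sign : ℝ) / (k.natAbs : ℝ) := by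
  rcases lt_or_gt_of_ne hk with h | h
  · have e : ((k.natAbs : ℕ) : ℝ) = -(k : ℝ) := by
      rw [Nat.cast_natAbs, Int.cast_abs, abs_of_neg (by exact_mod_cast h)]
    rw [Int.sign_eq_neg_one_of_neg h, e]
    have hk' : (k : ℝ) ≠ 0 := by exact_mod_cast hk
    push_cast
    field_simp
  · have e : ((k.natAbs : ℕ) : ℝ) = (k : ℝ) := by
      rw [Nat.cast_natAbs, Int.cast_abs, abs_of_pos (by exact_mod_cast h)]
    rw [Int.sign_eq_one_of_pos h, e]
    push_cast
    rfl

/-- A list sum as a `range` sum over `getD`. [cite: Moore1966, Ch. 3 (interval arithmetic: inclusion property)] -/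
theorem list_sum_map_eq_sum_range {α : Type} [Inhabited α] (g : α → ℝ) :
    ∀ l : List α, (l.map g).sum = ∑ i ∈ Finset.range l.length, g (l.getD i default)
  | [] => by simp
  | x :: xs => by
      rw [List.map_cons, List.sum_cons, List.length_cons, Finset.sum_range_succ', list_sum_map_eq_sum_range g xs]
      simp [add_comm]

/-! ## The prime sums -/

/-- `Σ_{i<k} wt_i · w_i · Re cs_i` (diagonal prime sum, sign apart). [cite: Yoshida1992HermitianForms, §5 (5.15) p. 301] -/
def primeDiagSum (S : ℕ) (wts ws : List MI) (cs : List MC) : ℕ → MI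
  | 0 => MI.ofInt S 0
  | i + 1 => (primeDiagSum S wts ws cs i).add
      (((wts.getD i default).mul S (ws.getD i default)).mul S (cs.getD i default).re)

/-- `Σ_{i<k} wt_i · (Im csm_i − Im csn_i)` (off-diagonal prime sum, prefactor apart).
[cite: Yoshida1992HermitianForms, §5 (5.16) p. 301] -/
def primeOffSum (S : ℕ) (wts : List MI) (csn csm : List MC) : ℕ → MI
  | 0 => MI.ofInt S 0
  | i + 1 => (primeOffSum S wts csn csm i).add
      ((wts.getD i default).mul S (((csm.getD i default).im).sub (csn.getD i default).im))

/-- `primeDiagSum` encloses `Σ_{i<k} Λ_i (2 − ℓ_i/a) cos(ω_n ℓ_i)`. [cite: Moore1966, Ch. 3 (interval arithmetic: inclusion property)] -/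
theorem mem_primeDiagSum (hS : 0 < S) {ks : List PrimeLen} {C : Consts} (hC : ConstsValid S a ks C)
    {n : ℤ} {R : IdxRec} (hR : OffValid S a ks n R) :
    ∀ k, k ≤ ks.length → MI.mem S (∑ i ∈ Finset.range k,
      (ks.getD i default).wt * (2 - (ks.getD i default).len / a) * Real.cos (freq a n * (ks.getD i default).len))
      (primeDiagSum S C.wts C.ws R.cs k)
  | 0, _ => by simpa [primeDiagSum] using MI.mem_ofInt S 0
  | k + 1, hk => by
      rw [Finset.sum_range_succ, primeDiagSum]
      have hk' : k < ks.length := hk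
      have hcos : MI.mem S (Real.cos (freq a n * (ks.getD k default).len)) (R.cs.getD k default).re := by
        have := (hR.cs k hk').1
        rwa [Complex.exp_ofReal_mul_I_re] at this
      exact MI.mem_add (mem_primeDiagSum hS hC hR k (by omega))
        (MI.mem_mul hS (MI.mem_mul hS (hC.wts k hk') (hC.ws k hk')) hcos)

/-- `primeOffSum` encloses `Σ_{i<k} Λ_i (sin(ω_m ℓ_i) − sin(ω_n ℓ_i))`. [cite: Moore1966, Ch. 3 (interval arithmetic: inclusion property)] -/
theorem mem_primeOffSum (hS : 0 < S) {ks : List PrimeLen} {C : Consts} (hC : ConstsValid S a ks C)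
    {n m : ℤ} {Rn Rm : IdxRec} (hn : OffValid S a ks n Rn) (hm : OffValid S a ks m Rm) :
    ∀ k, k ≤ ks.length → MI.mem S (∑ i ∈ Finset.range k,
      (ks.getD i default).wt * (Real.sin (freq a m * (ks.getD i default).len) - Real.sin (freq a n * (ks.getD i default).len)))
      (primeOffSum S C.wts Rn.cs Rm.cs k)
  | 0, _ => by simpa [primeOffSum] using MI.mem_ofInt S 0
  | k + 1, hk => by
      rw [Finset.sum_range_succ, primeOffSum]
      have hk' : k < ks.length := hk
      have hsn : MI.mem S (Real.sin (freq a n * (ks.getD k default).len)) (Rn.cs.getD k default).im := by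
        have := (hn.cs k hk').2
        rwa [Complex.exp_ofReal_mul_I_im] at this
      have hsm : MI.mem S (Real.sin (freq a m * (ks.getD k default).len)) (Rm.cs.getD k default).im := by
        have := (hm.cs k hk').2
        rwa [Complex.exp_ofReal_mul_I_im] at this
      exact MI.mem_add (mem_primeOffSum hS hC hn hm k (by omega))
        (MI.mem_mul hS (hC.wts k hk') (MI.mem_sub hsm hsn))

/-! ## The entry box -/

/-- The polar entry box `(−1)^{n+m}·polC·(1 − 4ω_nω_m)·c_n·c_m`. [cite: Yoshida1992HermitianForms, §5 (5.1) p. 297] -/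
def polBox (S : ℕ) (C : Consts) (Rn Rm : IdxRec) (n m : ℤ) : MI :=
  (((C.polC.mul S ((MI.ofInt S 1).sub ((Rn.om.mul S Rm.om).mulInt 4))).mul S Rn.c).mul S Rm.c).mulInt (sgn n m)

/-- The off-diagonal prefactor `x ↦ −(−1)^{n+m} x/(π(n−m))`. [cite: Yoshida1992HermitianForms, §5 (5.16) p. 301] -/
def offScale (S : ℕ) (C : Consts) (n m : ℤ) (X : MI) : MI :=
  ((X.mul S C.invPi).mulInt (-(sgn n m) * (n - m).sign)).divNat (n - m).natAbs

/-- **The entry box**: an interval for `gramCoeff a n m` from the constants and the two index records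
(diagonal formula (5.15) if `n = m`, off-diagonal (5.16) otherwise). [cite: Yoshida1992HermitianForms, §5 (5.15)-(5.16) p. 301] -/
def gramBox (S : ℕ) (C : Consts) (Rn Rm : IdxRec) (n m : ℤ) : MI :=
  if n = m then
    ((polBox S C Rn Rm n m).sub (primeDiagSum S C.wts C.ws Rn.cs C.wts.length)).add
      (((Rn.reP.sub C.logPi).add ((Rn.rePD.mul S C.invA).divNat 4)).sub (Rn.eD.mul S C.invA))
  else
    ((polBox S C Rn Rm n m).add (offScale S C n m (primeOffSum S C.wts Rn.cs Rm.cs C.wts.length))).add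
      (offScale S C n m (((Rm.imP.divNat 2).sub Rm.eS).sub ((Rn.imP.divNat 2).sub Rn.eS)))

/-- `polBox ∋ polarCoeff a n m`. [cite: Moore1966, Ch. 3 (interval arithmetic: inclusion property)] -/
theorem mem_polBox (hS : 0 < S) (ha0 : 0 < a) {ks : List PrimeLen} {C : Consts} (hC : ConstsValid S a ks C)
    {n m : ℤ} {Rn Rm : IdxRec} (hn : OffValid S a ks n Rn) (hm : OffValid S a ks m Rm) :
    MI.mem S (polarCoeff a n m) (polBox S C Rn Rm n m) := by
  have h := MI.mem_mulInt (MI.mem_mul hS (MI.mem_mul hS (MI.mem_mul hS hC.polC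
    (MI.mem_sub (MI.mem_ofInt S 1) (MI.mem_mulInt (MI.mem_mul hS hn.om hm.om) 4))) hn.c) hm.c) (sgn n m)
  refine mem_of_eq h ?_
  unfold polarCoeff
  rw [neg_one_zpow_eq_sgn]
  have h1 : (1 + 4 * freq a n ^ 2) ≠ 0 := by positivity
  have h2 : (1 + 4 * freq a m ^ 2) ≠ 0 := by positivity
  push_cast
  field_simp

/-- `offScale X ∋ −(−1)^{n+m} x/(π(n−m))` for `x ∈ X`, `n ≠ m`. [cite: Moore1966, Ch. 3 (interval arithmetic: inclusion property)] -/
theorem mem_offScale (hS : 0 < S) {ks : List PrimeLen} {C : Consts} (hC : ConstsValid S a ks C)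
    {n m : ℤ} (hnm : n ≠ m) {x : ℝ} {X : MI} (hx : MI.mem S x X) :
    MI.mem S (-(-1 : ℝ) ^ (n + m) / (π * (n - m)) * x) (offScale S C n m X) := by
  have hk : n - m ≠ 0 := sub_ne_zero.mpr hnm
  have h := MI.mem_divNat (MI.mem_mulInt (MI.mem_mul hS hx hC.invPi) (-(sgn n m) * (n - m).sign))
    (n := (n - m).natAbs) (Int.natAbs_pos.mpr hk)
  refine mem_of_eq h ?_
  rw [neg_one_zpow_eq_sgn]
  have e1 := inv_int_eq_sign_div_natAbs hk
  have hπ : (π : ℝ) ≠ 0 := Real.pi_ne_zero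
  have hnm' : ((n : ℝ) - m) ≠ 0 := by
    have : ((n - m : ℤ) : ℝ) ≠ 0 := by exact_mod_cast hk
    push_cast at this; exact this
  have hN : ((n - m).natAbs : ℝ) ≠ 0 := by
    have : (n - m).natAbs ≠ 0 := Int.natAbs_ne_zero.mpr hk
    exact_mod_cast this
  push_cast at e1 ⊢
  rw [show -(sgn n m : ℝ) / (π * ((n : ℝ) - m)) * x = -(sgn n m : ℝ) * (1 / π) * (1 / ((n : ℝ) - m)) * x by
    field_simp, e1]
  field_simp

/-- The matrix coefficient with the prime part written over an ARBITRARY list of prime powers `ks` (for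
`PrimeData a ks` this is `gramCoeff a n m`, `primeCoeff_eq_listSum`; for the semilocal forms `S = {∞} ∪ S₀` it is
the coefficient with the primes restricted to `S₀`). [cite: Yoshida1992HermitianForms, §5 (5.15)-(5.16) p. 301] -/
noncomputable def gramCoeffList (a : ℝ) (ks : List PrimeLen) (n m : ℤ) : ℝ :=
  polarCoeff a n m + (ks.map fun q ↦ q.wt * (incrCoeff a q.len n m - if n = m then 2 else 0)).sum + archCoeff a n m

/-- `gramCoeffList = gramCoeff` on the prime data of the window. [cite: Yoshida1992HermitianForms, §5 (5.15)-(5.16) p. 301] -/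
theorem gramCoeffList_eq_gramCoeff {ks : List PrimeLen} (hks : PrimeData a ks) (n m : ℤ) :
    gramCoeffList a ks n m = gramCoeff a n m := by
  rw [gramCoeffList, gramCoeff, primeCoeff_eq_listSum hks]

/-- **The entry box is sound (list form, no hypothesis on `ks`).**
[cite: Yoshida1992HermitianForms, §5 (5.15)-(5.16) p. 301] -/
theorem mem_gramBox_list (hS : 0 < S) (ha0 : 0 < a) {ks : List PrimeLen} {C : Consts}
    (hC : ConstsValid S a ks C) {n m : ℤ} {Rn Rm : IdxRec} (hn : OffValid S a ks n Rn)
    (hnd : n = m → DiagValid S a n Rn) (hm : OffValid S a ks m Rm) :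
    MI.mem S (gramCoeffList a ks n m) (gramBox S C Rn Rm n m) := by
  unfold gramBox gramCoeffList
  have hpol := mem_polBox hS ha0 hC hn hm
  rw [list_sum_map_eq_sum_range]
  by_cases hnm : n = m
  · -- diagonal entry (5.15)
    subst hnm
    have hd := hnd rfl
    simp only [if_true]
    -- prime part: `primeDiagSum ∋ −Σ wt (K − 2)`
    have hpri : MI.mem S (-(∑ i ∈ Finset.range ks.length, (ks.getD i default).wt *
        (incrCoeff a (ks.getD i default).len n n - 2)))
        (primeDiagSum S C.wts C.ws Rn.cs C.wts.length) := by
      rw [hC.wts_len]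
      refine mem_of_eq (mem_primeDiagSum hS hC hn ks.length le_rfl) ?_
      rw [← Finset.sum_neg_distrib]
      refine Finset.sum_congr rfl fun i _ ↦ ?_
      unfold incrCoeff
      simp only [if_true]
      ring
    -- archimedean part
    have harch : MI.mem S (archCoeff a n n)
        (((Rn.reP.sub C.logPi).add ((Rn.rePD.mul S C.invA).divNat 4)).sub (Rn.eD.mul S C.invA)) := by
      unfold archCoeff
      simp only [if_true]
      have h := MI.mem_sub (MI.mem_add (MI.mem_sub hd.reP hC.logPi)
        (MI.mem_divNat (MI.mem_mul hS hd.rePD hC.invA) (n := 4) (by norm_num))) (MI.mem_mul hS hd.eD hC.invA)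
      refine mem_of_eq h ?_
      have ha' : a ≠ 0 := ha0.ne'
      push_cast
      field_simp
    refine mem_of_eq (MI.mem_add (MI.mem_sub hpol hpri) harch) ?_
    ring
  · -- off-diagonal entry (5.16)
    simp only [hnm, if_false]
    have hpri : MI.mem S (∑ i ∈ Finset.range ks.length, (ks.getD i default).wt *
        (incrCoeff a (ks.getD i default).len n m - 0))
        (offScale S C n m (primeOffSum S C.wts Rn.cs Rm.cs C.wts.length)) := by
      rw [hC.wts_len]
      refine mem_of_eq (mem_offScale hS hC hnm (mem_primeOffSum hS hC hn hm ks.length le_rfl)) ?_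
      rw [Finset.mul_sum]
      refine Finset.sum_congr rfl fun i _ ↦ ?_
      unfold incrCoeff
      simp only [hnm, if_false]
      ring
    have harch : MI.mem S (archCoeff a n m)
        (offScale S C n m (((Rm.imP.divNat 2).sub Rm.eS).sub ((Rn.imP.divNat 2).sub Rn.eS))) := by
      unfold archCoeff
      simp only [hnm, if_false]
      refine mem_of_eq (mem_offScale hS hC hnm (MI.mem_sub
        (MI.mem_sub (MI.mem_divNat hm.imP (n := 2) (by norm_num)) hm.eS)
        (MI.mem_sub (MI.mem_divNat hn.imP (n := 2) (by norm_num)) hn.eS))) ?_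
      push_cast
      ring
    exact MI.mem_add (MI.mem_add hpol hpri) harch

/-- **The entry box is sound.**  With valid constants, prime data of the window, an off-diagonally valid record at
`n` that is also diagonally valid when `n = m`, and an off-diagonally valid record at `m`:
`gramCoeff a n m ∈ gramBox S C Rn Rm n m`. [cite: Yoshida1992HermitianForms, §5 (5.15)-(5.16) p. 301] -/
theorem mem_gramBox (hS : 0 < S) (ha0 : 0 < a) {ks : List PrimeLen} (hks : PrimeData a ks) {C : Consts}
    (hC : ConstsValid S a ks C) {n m : ℤ} {Rn Rm : IdxRec} (hn : OffValid S a ks n Rn)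
    (hnd : n = m → DiagValid S a n Rn) (hm : OffValid S a ks m Rm) :
    MI.mem S (gramCoeff a n m) (gramBox S C Rn Rm n m) := by
  rw [← gramCoeffList_eq_gramCoeff hks]
  exact mem_gramBox_list hS ha0 hC hn hnd hm

/-- The entry box with a DIAGONAL SHIFT `κ` (semilocal forms: the killing constant differs from `M_a` by a constant,
which moves every diagonal coefficient by the same amount). [cite: Yoshida1992HermitianForms, §5 (5.15) p. 301] -/
def gramBoxShift (S : ℕ) (C : Consts) (κ : MI) (Rn Rm : IdxRec) (n m : ℤ) : MI :=
  if n = m then (gramBox S C Rn Rm n m).add κ else gramBox S C Rn Rm n m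

/-- **Soundness of the shifted entry box** (list form). [cite: Yoshida1992HermitianForms, §5 (5.15)-(5.16) p. 301] -/
theorem mem_gramBoxShift (hS : 0 < S) (ha0 : 0 < a) {ks : List PrimeLen} {C : Consts}
    (hC : ConstsValid S a ks C) {κ : ℝ} {K : MI} (hκ : MI.mem S κ K) {n m : ℤ} {Rn Rm : IdxRec}
    (hn : OffValid S a ks n Rn) (hnd : n = m → DiagValid S a n Rn) (hm : OffValid S a ks m Rm) :
    MI.mem S (gramCoeffList a ks n m + if n = m then κ else 0) (gramBoxShift S C K Rn Rm n m) := by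
  unfold gramBoxShift
  have h := mem_gramBox_list hS ha0 hC hn hnd hm
  by_cases hnm : n = m
  · simp only [hnm, if_true]; subst hnm; exact MI.mem_add h hκ
  · simp only [hnm, if_false, add_zero]; exact h


/-! ## Containment of intervals and records -/

/-- `I ⊆ J`. [cite: Moore1966, Ch. 3 (interval arithmetic: inclusion property)] -/
def within (I J : MI) : Bool := decide (J.lo ≤ I.lo) && decide (I.hi ≤ J.hi)

/-- Containment transports membership. [cite: Moore1966, Ch. 3 (interval arithmetic: inclusion property)] -/
theorem mem_of_within {I J : MI} (h : within I J = true) {x : ℝ} (hx : MI.mem S x I) : MI.mem S x J := by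
  simp only [within, Bool.and_eq_true, decide_eq_true_eq] at h
  exact ⟨le_trans (by exact_mod_cast h.1) hx.1, le_trans hx.2 (by exact_mod_cast h.2)⟩

/-- `A ⊆ B` for boxes. [cite: Moore1966, Ch. 3 (interval arithmetic: inclusion property)] -/
def withinC (A B : MC) : Bool := within A.re B.re && within A.im B.im

/-- [cite: Moore1966, Ch. 3 (interval arithmetic: inclusion property)] -/
theorem memC_of_withinC {A B : MC} (h : withinC A B = true) {z : ℂ} (hz : MC.mem S z A) : MC.mem S z B := by
  simp only [withinC, Bool.and_eq_true] at h
  exact ⟨mem_of_within h.1 hz.1, mem_of_within h.2 hz.2⟩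

/-- Entrywise containment of two lists of intervals of equal length. [cite: Moore1966, Ch. 3 (interval arithmetic: inclusion property)] -/
def withinL : List MI → List MI → Bool
  | [], [] => true
  | I :: Is, J :: Js => within I J && withinL Is Js
  | _, _ => false

/-- [cite: Moore1966, Ch. 3 (interval arithmetic: inclusion property)] -/
theorem withinL_spec : ∀ {Is Js : List MI}, withinL Is Js = true →
    Js.length = Is.length ∧ ∀ i < Is.length, within (Is.getD i default) (Js.getD i default) = true
  | [], [], _ => by simp
  | [], _ :: _, h => by simp [withinL] at h
  | _ :: _, [], h => by simp [withinL] at h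
  | I :: Is, J :: Js, h => by
      simp only [withinL, Bool.and_eq_true] at h
      obtain ⟨hl, hi⟩ := withinL_spec h.2
      refine ⟨by simp [hl], fun i hi' ↦ ?_⟩
      cases i with
      | zero => simpa using h.1
      | succ i => simp only [List.getD_cons_succ]; exact hi i (by simpa using hi')

/-- Entrywise containment of two lists of boxes of equal length. [cite: Moore1966, Ch. 3 (interval arithmetic: inclusion property)] -/
def withinLC : List MC → List MC → Bool
  | [], [] => true
  | A :: As, B :: Bs => withinC A B && withinLC As Bs
  | _, _ => false

/-- [cite: Moore1966, Ch. 3 (interval arithmetic: inclusion property)] -/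
theorem withinLC_spec : ∀ {As Bs : List MC}, withinLC As Bs = true →
    Bs.length = As.length ∧ ∀ i < As.length, withinC (As.getD i default) (Bs.getD i default) = true
  | [], [], _ => by simp
  | [], _ :: _, h => by simp [withinLC] at h
  | _ :: _, [], h => by simp [withinLC] at h
  | A :: As, B :: Bs, h => by
      simp only [withinLC, Bool.and_eq_true] at h
      obtain ⟨hl, hi⟩ := withinLC_spec h.2
      refine ⟨by simp [hl], fun i hi' ↦ ?_⟩
      cases i with
      | zero => simpa using h.1
      | succ i => simp only [List.getD_cons_succ]; exact hi i (by simpa using hi')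

/-- Containment of constants records (`tailE` may only grow). [cite: Moore1966, Ch. 3 (interval arithmetic: inclusion property)] -/
def Consts.within (C D : Consts) : Bool :=
  Encl.within C.P D.P && Encl.within C.A D.A && Encl.within C.invA D.invA && Encl.within C.invPi D.invPi &&
    Encl.within C.logPi D.logPi && Encl.within C.polC D.polC && withinL C.eks D.eks && decide (C.tailE ≤ D.tailE) &&
    withinL C.lens D.lens && withinL C.wts D.wts && withinL C.ws D.ws

/-- Validity is monotone under containment of constants records. [cite: Moore1966, Ch. 3 (interval arithmetic: inclusion property)] -/
theorem ConstsValid.of_within {ks : List PrimeLen} {C D : Consts} (h : Consts.within C D = true)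
    (hC : ConstsValid S a ks C) : ConstsValid S a ks D := by
  simp only [Consts.within, Bool.and_eq_true, decide_eq_true_eq] at h
  obtain ⟨⟨⟨⟨⟨⟨⟨⟨⟨⟨hP, hA⟩, hiA⟩, hiP⟩, hlP⟩, hpC⟩, heks⟩, htail⟩, hlens⟩, hwts⟩, hws⟩ := h
  obtain ⟨hel, hei⟩ := withinL_spec heks
  obtain ⟨hll, hli⟩ := withinL_spec hlens
  obtain ⟨hwl, hwi⟩ := withinL_spec hwts
  obtain ⟨hsl, hsi⟩ := withinL_spec hws
  exact
    { pi := mem_of_within hP hC.pi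
      ha := mem_of_within hA hC.ha
      invA := mem_of_within hiA hC.invA
      invPi := mem_of_within hiP hC.invPi
      logPi := mem_of_within hlP hC.logPi
      polC := mem_of_within hpC hC.polC
      eks := fun k hk ↦ mem_of_within (hei k (by omega)) (hC.eks k (by omega))
      eks_pos := by rw [hel]; exact hC.eks_pos
      tail := by rw [hel]; exact le_trans hC.tail (by exact_mod_cast htail)
      lens_len := by rw [hll, hC.lens_len]
      wts_len := by rw [hwl, hC.wts_len]
      ws_len := by rw [hsl, hC.ws_len]
      lens := fun i hi ↦ mem_of_within (hli i (by rw [hC.lens_len]; exact hi)) (hC.lens i hi)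
      wts := fun i hi ↦ mem_of_within (hwi i (by rw [hC.wts_len]; exact hi)) (hC.wts i hi)
      ws := fun i hi ↦ mem_of_within (hsi i (by rw [hC.ws_len]; exact hi)) (hC.ws i hi) }

/-- Containment of index records. [cite: Moore1966, Ch. 3 (interval arithmetic: inclusion property)] -/
def IdxRec.within (R T : IdxRec) : Bool :=
  Encl.within R.om T.om && Encl.within R.c T.c && Encl.within R.imP T.imP && Encl.within R.eS T.eS &&
    withinLC R.cs T.cs && Encl.within R.reP T.reP && Encl.within R.rePD T.rePD && Encl.within R.eD T.eD

/-- Validity is monotone under containment of index records. [cite: Moore1966, Ch. 3 (interval arithmetic: inclusion property)] -/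
theorem IdxValid.of_within {ks : List PrimeLen} {n : ℕ} {R T : IdxRec} (h : IdxRec.within R T = true)
    (hR : IdxValid S a ks n R) : IdxValid S a ks n T := by
  simp only [IdxRec.within, Bool.and_eq_true] at h
  obtain ⟨⟨⟨⟨⟨⟨⟨hom, hc⟩, himP⟩, heS⟩, hcs⟩, hreP⟩, hrePD⟩, heD⟩ := h
  obtain ⟨hcl, hci⟩ := withinLC_spec hcs
  obtain ⟨hO, hD⟩ := hR
  exact ⟨{ om := mem_of_within hom hO.om, c := mem_of_within hc hO.c, imP := mem_of_within himP hO.imP,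
           eS := mem_of_within heS hO.eS, cs_len := by rw [hcl, hO.cs_len],
           cs := fun i hi ↦ memC_of_withinC (hci i (by rw [hO.cs_len]; exact hi)) (hO.cs i hi) },
         { reP := mem_of_within hreP hD.reP, rePD := mem_of_within hrePD hD.rePD, eD := mem_of_within heD hD.eD }⟩

/-! ## Certified inputs: `π`, `a` -/

/-- The claimed interval `P` contains `π` (recompute by Machin, test containment). [cite: Moore1966, Ch. 3 (interval arithmetic: inclusion property)] -/
def checkPi (S K : ℕ) (P : MI) : Bool :=
  match MI.piMachin S K with
  | some P' => within P' P
  | none => false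

/-- [cite: Moore1966, Ch. 3 (interval arithmetic: inclusion property)] -/
theorem mem_pi_of_checkPi (hS : 0 < S) {K : ℕ} {P : MI} (h : checkPi S K P = true) : MI.mem S Real.pi P := by
  unfold checkPi at h
  split at h
  · rename_i P' hP'; exact mem_of_within h (MI.mem_piMachin hS hP')
  · simp at h

/-- The claimed interval `A` contains `(log q)/2` (the windows `a = (log q)/2`). [cite: Moore1966, Ch. 3 (interval arithmetic: inclusion property)] -/
def checkHalfLogNat (S K q : ℕ) (A : MI) : Bool :=
  match MI.logNat2 S K q with
  | some L => within (L.divNat 2) A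
  | none => false

/-- [cite: Moore1966, Ch. 3 (interval arithmetic: inclusion property)] -/
theorem mem_of_checkHalfLogNat (hS : 0 < S) {K q : ℕ} {A : MI} (h : checkHalfLogNat S K q A = true) :
    MI.mem S (Real.log q / 2) A := by
  unfold checkHalfLogNat at h
  split at h
  · rename_i L hL
    have := MI.mem_divNat (MI.mem_logNat2 hS hL) (n := 2) (by norm_num)
    exact mem_of_within h (mem_of_eq this (by push_cast; ring))
  · simp at h

/-- The claimed interval `A` contains `pπ/q` (the windows `a ∈ πℚ`), given `P ∋ π`. [cite: Moore1966, Ch. 3 (interval arithmetic: inclusion property)] -/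
def checkPiFrac (p : ℤ) (q : ℕ) (P A : MI) : Bool := decide (0 < q) && within ((P.mulInt p).divNat q) A

/-- [cite: Moore1966, Ch. 3 (interval arithmetic: inclusion property)] -/
theorem mem_of_checkPiFrac {p : ℤ} {q : ℕ} {P A : MI} (hP : MI.mem S Real.pi P) (h : checkPiFrac p q P A = true) :
    MI.mem S (p * Real.pi / q) A := by
  simp only [checkPiFrac, Bool.and_eq_true, decide_eq_true_eq] at h
  have := MI.mem_divNat (MI.mem_mulInt hP p) h.1
  exact mem_of_within h.2 (mem_of_eq this (by ring))

/-- The claimed interval `A` contains `p/q` (rational windows). [cite: Moore1966, Ch. 3 (interval arithmetic: inclusion property)] -/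
def checkFrac (S : ℕ) (p : ℤ) (q : ℕ) (A : MI) : Bool := decide (0 < q) && within (MI.ofFrac S p q) A

/-- [cite: Moore1966, Ch. 3 (interval arithmetic: inclusion property)] -/
theorem mem_of_checkFrac {p : ℤ} {q : ℕ} {A : MI} (h : checkFrac S p q A = true) : MI.mem S ((p : ℝ) / q) A := by
  simp only [checkFrac, Bool.and_eq_true, decide_eq_true_eq] at h
  exact mem_of_within h.2 (MI.mem_ofFrac S p h.1)

/-! ## Packed table data (one natural per mode; cheap to elaborate, unpacked in the kernel) -/

/-- Read an index record from `14 + 4·nks` integers in the order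
`om, c, imP, eS, cs (re.lo re.hi im.lo im.hi per prime power), reP, rePD, eD`.
[cite: Moore1966, Ch. 3 (interval arithmetic: inclusion property)] -/
def IdxRec.ofInts (nks : ℕ) (l : List ℤ) : IdxRec :=
  let g : ℕ → ℤ := fun i ↦ l.getD i 0
  let cs : List MC := (List.range nks).map fun q ↦ ⟨⟨g (8 + 4 * q), g (9 + 4 * q)⟩, ⟨g (10 + 4 * q), g (11 + 4 * q)⟩⟩
  let o := 8 + 4 * nks
  ⟨⟨g 0, g 1⟩, ⟨g 2, g 3⟩, ⟨g 4, g 5⟩, ⟨g 6, g 7⟩, cs, ⟨g o, g (o + 1)⟩, ⟨g (o + 2), g (o + 3)⟩, ⟨g (o + 4), g (o + 5)⟩⟩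

/-- A table from packed rows: row `r` holds the `14 + 4·nks` integers of one mode as `w`-bit words with offset
`2^{w−1}` (`PsdDyadic.unpackRow`). [cite: Moore1966, Ch. 3 (interval arithmetic: inclusion property)] -/
def tabOfPacked (w nks : ℕ) (rows : List ℕ) : List IdxRec :=
  rows.map fun r ↦ IdxRec.ofInts nks (PsdDyadic.unpackRow (2 ^ w) (2 ^ (w - 1)) r (14 + 4 * nks))

/-! ## Certified prime data -/

/-- The listed values `p^e`. [cite: Moore1966, Ch. 3 (interval arithmetic: inclusion property)] -/
def primeVals (ks : List PrimeLen) : List ℕ := ks.map PrimeLen.val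

/-- Structural part of the prime data: primes, positive exponents, no repetition.
[cite: Moore1966, Ch. 3 (interval arithmetic: inclusion property)] -/
def checkPrimeList (ks : List PrimeLen) : Bool :=
  ks.all (fun x ↦ decide x.p.Prime && decide (0 < x.e)) && decide (primeVals ks).Nodup

/-- [cite: Moore1966, Ch. 3 (interval arithmetic: inclusion property)] -/
theorem primeList_spec {ks : List PrimeLen} (h : checkPrimeList ks = true) :
    (∀ x ∈ ks, x.p.Prime ∧ 0 < x.e) ∧ (primeVals ks).Nodup := by
  simp only [checkPrimeList, Bool.and_eq_true, List.all_eq_true, decide_eq_true_eq] at h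
  exact ⟨fun x hx ↦ h.1 x hx, h.2⟩

/-- Prime data of the window `a = (log q)/2` (no numerics: `log k < log q ↔ k < q`): the list is exactly the prime
powers below `q`. [cite: Yoshida1992HermitianForms, §5 (5.15) p. 301] -/
def checkPrimeDataHalfLog (q : ℕ) (ks : List PrimeLen) : Bool :=
  checkPrimeList ks && (primeVals ks).all (fun k ↦ decide (k < q)) &&
    (List.range q).all fun k ↦ !decide (IsPrimePow k) || (primeVals ks).contains k

/-- **Soundness of `checkPrimeDataHalfLog`**: `PrimeData ((log q)/2) ks`. [cite: Yoshida1992HermitianForms, §5 (5.15) p. 301] -/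
theorem primeData_of_checkHalfLog {q : ℕ} {ks : List PrimeLen} (h : checkPrimeDataHalfLog q ks = true) :
    PrimeData (Real.log q / 2) ks := by
  simp only [checkPrimeDataHalfLog, Bool.and_eq_true, List.all_eq_true, decide_eq_true_eq, Bool.or_eq_true,
    Bool.not_eq_true', decide_eq_false_iff_not, List.contains_iff_mem] at h
  obtain ⟨⟨hl, hlt⟩, hall⟩ := h
  obtain ⟨hp, hnd⟩ := primeList_spec hl
  refine ⟨hp, hnd, fun k hk ↦ ?_⟩
  rw [mem_weilPrimeIndex, show 2 * (Real.log q / 2) = Real.log q by ring]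
  have hk1 : 1 < k := hk.one_lt
  have hkpos : (0 : ℝ) < k := by exact_mod_cast (by omega : 0 < k)
  constructor
  · intro hlog
    have hkq : k < q := by
      refine lt_of_not_ge fun hc ↦ ?_
      have hq : 0 < q := by
        rcases Nat.eq_zero_or_pos q with rfl | hq
        · simp at hlog; linarith [Real.log_pos (by exact_mod_cast hk1 : (1:ℝ) < k)]
        · exact hq
      have : Real.log q ≤ Real.log k := Real.log_le_log (by exact_mod_cast hq) (by exact_mod_cast hc)
      linarith
    rcases hall k (List.mem_range.mpr hkq) with h' | h'
    · exact absurd hk h'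
    · exact h'
  · intro hmem
    have hkq := hlt k hmem
    exact Real.log_lt_log hkpos (by exact_mod_cast hkq)

/-- Strict separation above the window: `2a < log k` certified by intervals (`A2 ∋ 2a`).
[cite: Moore1966, Ch. 3 (interval arithmetic: inclusion property)] -/
def sepAbove (S K : ℕ) (A2 : MI) (k : ℕ) : Bool :=
  match MI.logNat2 S K k with
  | some L => decide (A2.hi < L.lo)
  | none => false

/-- [cite: Moore1966, Ch. 3 (interval arithmetic: inclusion property)] -/
theorem lt_log_of_sepAbove (hS : 0 < S) {K : ℕ} {A2 : MI} (h2a : MI.mem S (2 * a) A2) {k : ℕ}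
    (h : sepAbove S K A2 k = true) : 2 * a < Real.log k := by
  unfold sepAbove at h
  split at h
  · rename_i L hL
    simp only [decide_eq_true_eq] at h
    exact MI.lt_of_hi_lt_lo h2a (MI.mem_logNat2 hS hL) h
  · simp at h

/-- Strict separation inside the window: `log k < 2a` certified by intervals.
[cite: Moore1966, Ch. 3 (interval arithmetic: inclusion property)] -/
def sepBelow (S K : ℕ) (A2 : MI) (k : ℕ) : Bool :=
  match MI.logNat2 S K k with
  | some L => decide (L.hi < A2.lo)
  | none => false

/-- [cite: Moore1966, Ch. 3 (interval arithmetic: inclusion property)] -/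
theorem log_lt_of_sepBelow (hS : 0 < S) {K : ℕ} {A2 : MI} (h2a : MI.mem S (2 * a) A2) {k : ℕ}
    (h : sepBelow S K A2 k = true) : Real.log k < 2 * a := by
  unfold sepBelow at h
  split at h
  · rename_i L hL
    simp only [decide_eq_true_eq] at h
    exact MI.lt_of_hi_lt_lo (MI.mem_logNat2 hS hL) h2a h
  · simp at h

/-- Prime data of a general window by STRICT interval separation: every listed prime power has `log k < 2a`, every
unlisted prime power `k ≤ kmax` has `log k > 2a`, and `log (kmax + 1) > 2a`.
[cite: Moore1966, Ch. 3 (interval arithmetic: inclusion property)] -/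
def checkPrimeDataSep (S K : ℕ) (A : MI) (kmax : ℕ) (ks : List PrimeLen) : Bool :=
  checkPrimeList ks && (primeVals ks).all (sepBelow S K (A.mulInt 2)) && sepAbove S K (A.mulInt 2) (kmax + 1) &&
    (List.range (kmax + 1)).all fun k ↦
      (primeVals ks).contains k || !decide (IsPrimePow k) || sepAbove S K (A.mulInt 2) k

/-- **Soundness of `checkPrimeDataSep`**: `PrimeData a ks` for `a ∈ A`. [cite: Moore1966, Ch. 3 (interval arithmetic: inclusion property)] -/
theorem primeData_of_checkSep (hS : 0 < S) {K : ℕ} {A : MI} (ha : MI.mem S a A) {kmax : ℕ} {ks : List PrimeLen}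
    (h : checkPrimeDataSep S K A kmax ks = true) : PrimeData a ks := by
  simp only [checkPrimeDataSep, Bool.and_eq_true, List.all_eq_true, Bool.or_eq_true, Bool.not_eq_true',
    decide_eq_false_iff_not, List.contains_iff_mem] at h
  obtain ⟨⟨⟨hl, hin⟩, htop⟩, hout⟩ := h
  obtain ⟨hp, hnd⟩ := primeList_spec hl
  have h2a : MI.mem S (2 * a) (A.mulInt 2) := mem_of_eq (MI.mem_mulInt ha 2) (by push_cast; ring)
  have hmax := lt_log_of_sepAbove hS h2a htop
  refine ⟨hp, hnd, fun k hk ↦ ?_⟩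
  rw [mem_weilPrimeIndex]
  constructor
  · intro hlog
    have hkle : k < kmax + 1 := by
      refine lt_of_not_ge fun hc ↦ ?_
      have : Real.log ((kmax + 1 : ℕ) : ℝ) ≤ Real.log k :=
        Real.log_le_log (by positivity) (by exact_mod_cast hc)
      linarith
    rcases hout k (List.mem_range.mpr hkle) with (h' | h') | h'
    · exact h'
    · exact absurd hk h'
    · linarith [lt_log_of_sepAbove hS h2a h']
  · intro hmem; exact log_lt_of_sepBelow hS h2a (hin k hmem)

/-! ## Certified constants and tables -/

/-- The claimed constants record `D` is valid: recompute and test containment. [cite: Moore1966, Ch. 3 (interval arithmetic: inclusion property)] -/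
def checkConsts (prm : Params) (P A : MI) (ks : List PrimeLen) (D : Consts) : Bool :=
  match consts prm P A ks with
  | some C => Consts.within C D
  | none => false

/-- **Soundness of `checkConsts`.** [cite: Moore1966, Ch. 3 (interval arithmetic: inclusion property)] -/
theorem constsValid_of_checkConsts {prm : Params} (hS : 0 < prm.S) (hK : 1 ≤ prm.Kexp) {P A : MI}
    (hpi : MI.mem prm.S Real.pi P) (ha : MI.mem prm.S a A) {ks : List PrimeLen} {D : Consts}
    (h : checkConsts prm P A ks D = true) : ConstsValid prm.S a ks D := by
  unfold checkConsts at h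
  split at h
  · rename_i C hC; exact ConstsValid.of_within h (constsValid_of_consts hS hK hpi ha hC)
  · simp at h

/-- Table lookup (default record beyond the end). [cite: Moore1966, Ch. 3 (interval arithmetic: inclusion property)] -/
def tget (tab : List IdxRec) (n : ℕ) : IdxRec := tab.getD n default

/-- The claimed table entries at the modes `n0 ≤ n < n0 + k` are valid: recompute each and test containment.
[cite: Moore1966, Ch. 3 (interval arithmetic: inclusion property)] -/
def checkTable (prm : Params) (C : Consts) (tab : List IdxRec) (n0 k : ℕ) : Bool :=
  (List.range k).all fun i ↦
    match idxRec prm C (n0 + i) with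
    | some R => IdxRec.within R (tget tab (n0 + i))
    | none => false

/-- **Soundness of `checkTable`.** [cite: Moore1966, Ch. 3 (interval arithmetic: inclusion property)] -/
theorem idxValid_of_checkTable {prm : Params} (hS : 0 < prm.S) (ha0 : 0 < a) {ks : List PrimeLen} {C : Consts}
    (hC : ConstsValid prm.S a ks C) {tab : List IdxRec} {n0 k : ℕ} (h : checkTable prm C tab n0 k = true)
    {n : ℕ} (hn : n0 ≤ n) (hnk : n < n0 + k) : IdxValid prm.S a ks n (tget tab n) := by
  unfold checkTable at h
  rw [List.all_eq_true] at h
  have hi := h (n - n0) (List.mem_range.mpr (by omega))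
  rw [show n0 + (n - n0) = n by omega] at hi
  split at hi
  · rename_i R hR; exact IdxValid.of_within hi (idxValid_of_idxRec hS ha0 hC hR)
  · simp at hi

/-- A table is valid below `N`. [cite: Moore1966, Ch. 3 (interval arithmetic: inclusion property)] -/
def TabValid (S : ℕ) (a : ℝ) (ks : List PrimeLen) (N : ℕ) (tab : List IdxRec) : Prop :=
  ∀ n < N, IdxValid S a ks n (tget tab n)

/-- Glue two consecutive certified slices. [cite: Moore1966, Ch. 3 (interval arithmetic: inclusion property)] -/
theorem TabValid.extend {ks : List PrimeLen} {N k : ℕ} {tab : List IdxRec} (h1 : TabValid S a ks N tab)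
    (h2 : ∀ n, N ≤ n → n < N + k → IdxValid S a ks n (tget tab n)) : TabValid S a ks (N + k) tab :=
  fun n hn ↦ if h : n < N then h1 n h else h2 n (by omega) hn

/-- The empty slice. [cite: Moore1966, Ch. 3 (interval arithmetic: inclusion property)] -/
theorem TabValid.zero {ks : List PrimeLen} {tab : List IdxRec} : TabValid S a ks 0 tab := fun _ h ↦ absurd h (by omega)

/-! ## Reflection symmetry of Yoshida's matrix (Literature-side; the sector kernels are symmetric) -/

/-- `ψ′(s̄) = conj ψ′(s)`. [cite: Yoshida1992HermitianForms, §6 (6.10) p. 303] -/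
theorem deriv_digamma_conj (s : ℂ) :
    deriv Complex.digamma ((starRingEnd ℂ) s) = (starRingEnd ℂ) (deriv Complex.digamma s) := by
  have hc : ((starRingEnd ℂ) ∘ Complex.digamma ∘ (starRingEnd ℂ)) = Complex.digamma := by
    funext z; simp [digamma_conj]
  have h := congr_fun (deriv_conj_conj (f := Complex.digamma)) ((starRingEnd ℂ) s)
  rw [hc] at h
  simpa using h

/-- `Re ψ′(¼ − iω/2) = Re ψ′(¼ + iω/2)`. [cite: Yoshida1992HermitianForms, §6 (6.10) p. 303] -/
theorem re_deriv_digamma_quarter_neg (ω : ℝ) :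
    (deriv Complex.digamma (1 / 4 + (((-ω : ℝ)) : ℂ) / 2 * I)).re =
      (deriv Complex.digamma (1 / 4 + (ω : ℂ) / 2 * I)).re := by
  rw [quarter_add_neg_eq_conj, deriv_digamma_conj, Complex.conj_re]

/-- `(−1)^{−n−m} = (−1)^{n+m}`. [cite: Yoshida1992HermitianForms, §6 (6.10) p. 303] -/
theorem neg_one_zpow_neg_add_neg (n m : ℤ) : (-1 : ℝ) ^ (-n + -m) = (-1) ^ (n + m) := by
  rw [show -n + -m = -(n + m) by ring]
  rcases Int.even_or_odd (n + m) with h | h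
  · rw [h.neg_one_zpow, h.neg.neg_one_zpow]
  · rw [h.neg_one_zpow, h.neg.neg_one_zpow]

/-- `POL(−n,−m) = POL(n,m)`. [cite: Yoshida1992HermitianForms, §6 (6.10) p. 303] -/
theorem polarCoeff_neg_neg (a : ℝ) (n m : ℤ) : polarCoeff a (-n) (-m) = polarCoeff a n m := by
  unfold polarCoeff
  rw [freq_neg, freq_neg, neg_one_zpow_neg_add_neg]
  ring

/-- `K_t(−n,−m) = K_t(n,m)`. [cite: Yoshida1992HermitianForms, §6 (6.10) p. 303] -/
theorem incrCoeff_neg_neg (a t : ℝ) (n m : ℤ) : incrCoeff a t (-n) (-m) = incrCoeff a t n m := by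
  unfold incrCoeff
  by_cases h : n = m
  · subst h
    simp only [if_true, freq_neg, neg_mul, Real.cos_neg]
  · have hd : (π * (((-n : ℤ) : ℝ) - ((-m : ℤ) : ℝ))) = -(π * ((n : ℝ) - m)) := by push_cast; ring
    rw [if_neg (fun h' ↦ h (neg_inj.1 h')), if_neg h, freq_neg, freq_neg, neg_one_zpow_neg_add_neg, hd]
    simp only [neg_mul, Real.sin_neg, div_neg]
    ring

/-- `PRI(−n,−m) = PRI(n,m)`. [cite: Yoshida1992HermitianForms, §6 (6.10) p. 303] -/
theorem primeCoeff_neg_neg (a : ℝ) (n m : ℤ) : primeCoeff a (-n) (-m) = primeCoeff a n m := by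
  unfold primeCoeff
  refine Finset.sum_congr rfl fun k _ ↦ ?_
  rw [incrCoeff_neg_neg]
  by_cases h : n = m
  · subst h; simp
  · rw [if_neg (fun h' ↦ h (neg_inj.1 h')), if_neg h]

/-- The diagonal exponential sum is even in the mode. [cite: Yoshida1992HermitianForms, §6 (6.10) p. 303] -/
theorem archExpSumDiag_neg (a : ℝ) (n : ℤ) : archExpSumDiag a (-n) = archExpSumDiag a n := by
  unfold archExpSumDiag; simp only [freq_neg, neg_sq]

/-- `ARCH(−n,−m) = ARCH(n,m)`. [cite: Yoshida1992HermitianForms, §6 (6.10) p. 303] -/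
theorem archCoeff_neg_neg (a : ℝ) (n m : ℤ) : archCoeff a (-n) (-m) = archCoeff a n m := by
  unfold archCoeff
  by_cases h : n = m
  · subst h
    simp only [if_true]
    rw [archExpSumDiag_neg, freq_neg, reDigammaQuarter_even, re_deriv_digamma_quarter_neg]
  · rw [if_neg (fun h' ↦ h (neg_inj.1 h')), if_neg h, archExpSumSin_neg, archExpSumSin_neg, freq_neg, freq_neg,
      im_digamma_quarter_neg, im_digamma_quarter_neg, neg_one_zpow_neg_add_neg]
    have hd : (π * (((-n : ℤ) : ℝ) - ((-m : ℤ) : ℝ))) = -(π * ((n : ℝ) - m)) := by push_cast; ring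
    rw [hd]
    simp only [div_neg, neg_div]
    ring

/-- **`(χ_{−n}, χ_{−m}) = (χ_n, χ_m)`**: reflection invariance of Yoshida's matrix.
[cite: Yoshida1992HermitianForms, §6 (6.10) p. 303] -/
theorem gramCoeff_neg_neg (a : ℝ) (n m : ℤ) : gramCoeff a (-n) (-m) = gramCoeff a n m := by
  rw [gramCoeff, gramCoeff, polarCoeff_neg_neg, primeCoeff_neg_neg, archCoeff_neg_neg]

/-! ## The sector kernels and their boxes -/

/-- The EVEN sector kernel of a reflection-symmetric `G` (conventions of `WeilFormatCSectorKernels`).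
[cite: Yoshida1992HermitianForms, §6 (6.10) p. 303] -/
noncomputable def evenKernel (G : ℤ → ℤ → ℝ) (n m : ℕ) : ℝ :=
  if n = 0 then G 0 m else if m = 0 then G n 0 else (G n m + G n (-(m : ℤ))) / 2

/-- The ODD sector kernel. [cite: Yoshida1992HermitianForms, §6 (6.10) p. 303] -/
noncomputable def oddKernel (G : ℤ → ℤ → ℝ) (k l : ℕ) : ℝ :=
  (G ((k : ℤ) + 1) ((l : ℤ) + 1) - G ((k : ℤ) + 1) (-((l : ℤ) + 1))) / 2

/-- The sector kernel (`odd = false`: even). [cite: Yoshida1992HermitianForms, §6 (6.10) p. 303] -/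
noncomputable def sectorKernel (odd : Bool) (G : ℤ → ℤ → ℝ) (i j : ℕ) : ℝ :=
  if odd then oddKernel G i j else evenKernel G i j

/-- Box of an even sector-kernel entry. [cite: Moore1966, Ch. 3 (interval arithmetic: inclusion property)] -/
def evenBox (S : ℕ) (C : Consts) (tab : List IdxRec) (n m : ℕ) : MI :=
  if n = 0 then gramBox S C (tget tab 0) (tget tab m) 0 m
  else if m = 0 then gramBox S C (tget tab n) (tget tab 0) n 0
  else ((gramBox S C (tget tab n) (tget tab m) n m).add
    (gramBox S C (tget tab n) (tget tab m).flip n (-(m : ℤ)))).divNat 2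

/-- Box of an odd sector-kernel entry. [cite: Moore1966, Ch. 3 (interval arithmetic: inclusion property)] -/
def oddBox (S : ℕ) (C : Consts) (tab : List IdxRec) (k l : ℕ) : MI :=
  ((gramBox S C (tget tab (k + 1)) (tget tab (l + 1)) ((k : ℤ) + 1) ((l : ℤ) + 1)).sub
    (gramBox S C (tget tab (k + 1)) (tget tab (l + 1)).flip ((k : ℤ) + 1) (-((l : ℤ) + 1)))).divNat 2

/-- Box of a sector-kernel entry. [cite: Moore1966, Ch. 3 (interval arithmetic: inclusion property)] -/
def sectorBox (odd : Bool) (S : ℕ) (C : Consts) (tab : List IdxRec) (i j : ℕ) : MI :=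
  if odd then oddBox S C tab i j else evenBox S C tab i j

/-- The even kernel of a symmetric, reflection-symmetric `G` is symmetric. [cite: Yoshida1992HermitianForms, §6 (6.10) p. 303] -/
theorem evenKernel_comm {G : ℤ → ℤ → ℝ} (hs : ∀ n m, G n m = G m n) (hr : ∀ n m, G (-n) (-m) = G n m) (n m : ℕ) :
    evenKernel G n m = evenKernel G m n := by
  unfold evenKernel
  by_cases hn : n = 0
  · subst hn
    by_cases hm : m = 0
    · subst hm; simp
    · simp only [if_true, hm, if_false]; exact hs _ _
  · by_cases hm : m = 0
    · subst hm; simp only [hn, if_false, if_true]; exact hs _ _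
    · simp only [hn, hm, if_false]
      rw [hs (n : ℤ) m, hs (n : ℤ) (-(m : ℤ)), ← hr (-(m : ℤ)) n, neg_neg]

/-- The odd kernel of a symmetric, reflection-symmetric `G` is symmetric. [cite: Yoshida1992HermitianForms, §6 (6.10) p. 303] -/
theorem oddKernel_comm {G : ℤ → ℤ → ℝ} (hs : ∀ n m, G n m = G m n) (hr : ∀ n m, G (-n) (-m) = G n m) (k l : ℕ) :
    oddKernel G k l = oddKernel G l k := by
  unfold oddKernel
  rw [hs ((k : ℤ) + 1) ((l : ℤ) + 1), hs ((k : ℤ) + 1) (-((l : ℤ) + 1)), ← hr (-((l : ℤ) + 1)) ((k : ℤ) + 1),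
    neg_neg]

/-- The sector kernels of `gramCoeff a` are symmetric. [cite: Yoshida1992HermitianForms, §6 (6.10) p. 303] -/
theorem sectorKernel_gramCoeff_comm (odd : Bool) (a : ℝ) (i j : ℕ) :
    sectorKernel odd (gramCoeff a) i j = sectorKernel odd (gramCoeff a) j i := by
  cases odd
  · simpa [sectorKernel] using evenKernel_comm (gramCoeff_comm a) (gramCoeff_neg_neg a) i j
  · simpa [sectorKernel] using oddKernel_comm (gramCoeff_comm a) (gramCoeff_neg_neg a) i j

/-- The SYMMETRISED box of a sector-kernel entry (the box of the entry `(min, max)`), so that midpoint data read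
off these boxes is symmetric by construction. [cite: Moore1966, Ch. 3 (interval arithmetic: inclusion property)] -/
def sectorBoxSym (odd : Bool) (S : ℕ) (C : Consts) (tab : List IdxRec) (i j : ℕ) : MI :=
  if i ≤ j then sectorBox odd S C tab i j else sectorBox odd S C tab j i

variable {ks : List PrimeLen} {C : Consts} {tab : List IdxRec} {N : ℕ}

/-- `evenBox ∋ M⁺(n,m)` for modes below the table bound. [cite: Moore1966, Ch. 3 (interval arithmetic: inclusion property)] -/
theorem mem_evenBox (hS : 0 < S) (ha0 : 0 < a) (hks : PrimeData a ks) (hC : ConstsValid S a ks C)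
    (hT : TabValid S a ks N tab) {n m : ℕ} (hn : n < N) (hm : m < N) :
    MI.mem S (evenKernel (gramCoeff a) n m) (evenBox S C tab n m) := by
  unfold evenKernel evenBox
  have h0 : 0 < N := by omega
  by_cases hn0 : n = 0
  · subst hn0
    simp only [if_true]
    have := mem_gramBox hS ha0 hks hC (hT 0 h0).1 (fun _ ↦ (hT 0 h0).2) (hT m hm).1
    simpa using this
  · simp only [hn0, if_false]
    by_cases hm0 : m = 0
    · subst hm0
      simp only [if_true]
      have := mem_gramBox hS ha0 hks hC (hT n hn).1 (fun _ ↦ (hT n hn).2) (hT 0 h0).1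
      simpa using this
    · simp only [hm0, if_false]
      have h1 := mem_gramBox hS ha0 hks hC (hT n hn).1 (fun _ ↦ (hT n hn).2) (hT m hm).1
      have h2 := mem_gramBox hS ha0 hks hC (hT n hn).1
        (fun h ↦ absurd h (by omega)) (OffValid.flip (hT m hm).1)
      have := MI.mem_divNat (MI.mem_add h1 h2) (n := 2) (by norm_num)
      exact mem_of_eq this (by push_cast; ring)

/-- `oddBox ∋ M⁻(k,l)` for modes below the table bound. [cite: Moore1966, Ch. 3 (interval arithmetic: inclusion property)] -/
theorem mem_oddBox (hS : 0 < S) (ha0 : 0 < a) (hks : PrimeData a ks) (hC : ConstsValid S a ks C)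
    (hT : TabValid S a ks N tab) {k l : ℕ} (hk : k + 1 < N) (hl : l + 1 < N) :
    MI.mem S (oddKernel (gramCoeff a) k l) (oddBox S C tab k l) := by
  unfold oddKernel oddBox
  have ek : ((k + 1 : ℕ) : ℤ) = (k : ℤ) + 1 := by push_cast; ring
  have el : ((l + 1 : ℕ) : ℤ) = (l : ℤ) + 1 := by push_cast; ring
  have hkO := (hT (k + 1) hk).1
  have hkD := (hT (k + 1) hk).2
  have hlO := (hT (l + 1) hl).1
  rw [ek] at hkO hkD
  rw [el] at hlO
  have h1 := mem_gramBox hS ha0 hks hC hkO (fun _ ↦ hkD) hlO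
  have h2 := mem_gramBox hS ha0 hks hC hkO (fun h ↦ absurd h (by omega)) (OffValid.flip hlO)
  have := MI.mem_divNat (MI.mem_sub h1 h2) (n := 2) (by norm_num)
  exact mem_of_eq this (by push_cast; ring)

/-- `sectorBox ∋ M^σ(i,j)` (even: `i, j < N`; odd: `i + 1, j + 1 < N`). [cite: Moore1966, Ch. 3 (interval arithmetic: inclusion property)] -/
theorem mem_sectorBox (hS : 0 < S) (ha0 : 0 < a) (hks : PrimeData a ks) (hC : ConstsValid S a ks C)
    (hT : TabValid S a ks N tab) (odd : Bool) {i j : ℕ} (hi : i + 1 < N) (hj : j + 1 < N) :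
    MI.mem S (sectorKernel odd (gramCoeff a) i j) (sectorBox odd S C tab i j) := by
  cases odd
  · simpa [sectorKernel, sectorBox] using mem_evenBox hS ha0 hks hC hT (by omega) (by omega)
  · simpa [sectorKernel, sectorBox] using mem_oddBox hS ha0 hks hC hT hi hj

/-- `sectorBoxSym ∋ M^σ(i,j)`. [cite: Moore1966, Ch. 3 (interval arithmetic: inclusion property)] -/
theorem mem_sectorBoxSym (hS : 0 < S) (ha0 : 0 < a) (hks : PrimeData a ks) (hC : ConstsValid S a ks C)
    (hT : TabValid S a ks N tab) (odd : Bool) {i j : ℕ} (hi : i + 1 < N) (hj : j + 1 < N) :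
    MI.mem S (sectorKernel odd (gramCoeff a) i j) (sectorBoxSym odd S C tab i j) := by
  unfold sectorBoxSym
  split_ifs with h
  · exact mem_sectorBox hS ha0 hks hC hT odd hi hj
  · rw [sectorKernel_gramCoeff_comm]; exact mem_sectorBox hS ha0 hks hC hT odd hj hi

/-! ## Enclosure of the sector kernel by integer data (the `hM` of `PsdDyadic.psd_of_checkPsdMid`) -/

/-- The datum `d` at unit `2^{−c}` with radius `ρ` encloses the interval `X` (scale `S`). [cite: Moore1966, Ch. 3 (interval arithmetic: inclusion property)] -/
def enclCheck (S c : ℕ) (ρ d : ℤ) (X : MI) : Bool :=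
  decide ((d - ρ) * S ≤ X.lo * 2 ^ c) && decide (X.hi * 2 ^ c ≤ (d + ρ) * S)

/-- **Soundness of `enclCheck`**: `|x − d·2^{−c}| ≤ ρ·2^{−c}` for `x ∈ X`. [cite: Moore1966, Ch. 3 (interval arithmetic: inclusion property)] -/
theorem abs_sub_le_of_enclCheck (hS : 0 < S) {c : ℕ} {ρ d : ℤ} {X : MI} (h : enclCheck S c ρ d X = true)
    {x : ℝ} (hx : MI.mem S x X) : |x - (d : ℝ) * (1 / 2 ^ c)| ≤ (ρ : ℝ) * (1 / 2 ^ c) := by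
  simp only [enclCheck, Bool.and_eq_true, decide_eq_true_eq] at h
  have hSr : (0 : ℝ) < S := by exact_mod_cast hS
  have h2 : (0 : ℝ) < 2 ^ c := by positivity
  have hl : ((d : ℝ) - ρ) * S ≤ (X.lo : ℝ) * 2 ^ c := by exact_mod_cast h.1
  have hh : (X.hi : ℝ) * 2 ^ c ≤ ((d : ℝ) + ρ) * S := by exact_mod_cast h.2
  have hlo := hx.1
  have hhi := hx.2
  rw [abs_le]
  constructor
  · -- lower: d/2^c − ρ/2^c ≤ x
    have : ((d : ℝ) - ρ) * S * 1 ≤ x * S * 2 ^ c := by nlinarith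
    have h3 : ((d : ℝ) - ρ) ≤ x * 2 ^ c := by nlinarith
    rw [show (d : ℝ) * (1 / 2 ^ c) = d / 2 ^ c by ring, show (ρ : ℝ) * (1 / 2 ^ c) = ρ / 2 ^ c by ring]
    rw [le_sub_iff_add_le, neg_add_eq_sub, div_sub_div_same, div_le_iff₀ h2]
    linarith
  · have h3 : x * 2 ^ c ≤ (d : ℝ) + ρ := by nlinarith
    rw [show (d : ℝ) * (1 / 2 ^ c) = d / 2 ^ c by ring, show (ρ : ℝ) * (1 / 2 ^ c) = ρ / 2 ^ c by ring]
    rw [sub_le_iff_le_add, ← add_div, le_div_iff₀ h2]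
    linarith

/-- Check a band of rows `i0 ≤ i < i0 + k` against all columns `j < B`. [cite: Moore1966, Ch. 3 (interval arithmetic: inclusion property)] -/
def checkRows (S c : ℕ) (ρ : ℤ) (C : Consts) (tab : List IdxRec) (odd : Bool) (B : ℕ) (D : List (List ℤ))
    (i0 k : ℕ) : Bool :=
  (List.range k).all fun di ↦ (List.range B).all fun j ↦
    enclCheck S c ρ (PsdDyadic.getMZ D (i0 + di) j) (sectorBoxSym odd S C tab (i0 + di) j)

/-- **Soundness of `checkRows`**: on the band, the data `D` encloses the sector kernel of `gramCoeff a` within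
`ρ·2^{−c}` (the table must be valid below `B + 1`). [cite: Moore1966, Ch. 3 (interval arithmetic: inclusion property)] -/
theorem near_of_checkRows (hS : 0 < S) (ha0 : 0 < a) (hks : PrimeData a ks) (hC : ConstsValid S a ks C)
    {B : ℕ} (hT : TabValid S a ks (B + 1) tab) {c : ℕ} {ρ : ℤ} {odd : Bool} {D : List (List ℤ)} {i0 k : ℕ}
    (h : checkRows S c ρ C tab odd B D i0 k = true) {i j : ℕ} (hi : i0 ≤ i) (hik : i < i0 + k) (hj : j < B)
    (hiB : i < B) :
    |sectorKernel odd (gramCoeff a) i j - (PsdDyadic.getMZ D i j : ℝ) * (1 / 2 ^ c)| ≤ (ρ : ℝ) * (1 / 2 ^ c) := by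
  unfold checkRows at h
  rw [List.all_eq_true] at h
  have h1 := h (i - i0) (List.mem_range.mpr (by omega))
  rw [List.all_eq_true] at h1
  have h2 := h1 j (List.mem_range.mpr hj)
  rw [show i0 + (i - i0) = i by omega] at h2
  exact abs_sub_le_of_enclCheck hS h2 (mem_sectorBoxSym hS ha0 hks hC hT odd (by omega) (by omega))

/-- Folding a dyadic majorant into the data: if `D` encloses `M` within `ρ` then `D − Uz` encloses `M − Uz·2^{−c}`
within `ρ` (so the `(P)` certificate is run on `mid = D − Uz`). [cite: Moore1966, Ch. 3 (interval arithmetic: inclusion property)] -/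
theorem near_sub_of_near {B c : ℕ} {ρ : ℤ} {M : ℕ → ℕ → ℝ} {D Uz mid : List (List ℤ)}
    (hmid : ∀ i j : Fin B, PsdDyadic.getMZ mid i j = PsdDyadic.getMZ D i j - PsdDyadic.getMZ Uz i j)
    (hM : ∀ i j : Fin B, |M i j - (PsdDyadic.getMZ D i j : ℝ) * (1 / 2 ^ c)| ≤ (ρ : ℝ) * (1 / 2 ^ c))
    (i j : Fin B) :
    |(M i j - (PsdDyadic.getMZ Uz i j : ℝ) * (1 / 2 ^ c)) - (PsdDyadic.getMZ mid i j : ℝ) * (1 / 2 ^ c)|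
      ≤ (ρ : ℝ) * (1 / 2 ^ c) := by
  rw [hmid i j]; push_cast
  have := hM i j
  rw [show M i j - (PsdDyadic.getMZ Uz i j : ℝ) * (1 / 2 ^ c) -
      ((PsdDyadic.getMZ D i j : ℝ) - PsdDyadic.getMZ Uz i j) * (1 / 2 ^ c)
      = M i j - (PsdDyadic.getMZ D i j : ℝ) * (1 / 2 ^ c) by ring]
  exact this

end Encl

end Literature.NumberTheory.LFunctions.Yoshida1992
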